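import Summits.KontsevichZagierPeriods.KontsevichZagierPeriods.Theorems.RootDecompZetaThreeFrontierGZLadderFourPolarP11

/-! # `RootDecompZetaThreeFrontierGZLadderFourPolarP11` — part 11/12 of the mechanical ≤400-line split of `l4_src.lean` (sha256 5cc5a9ee4c47da9a…)
Source: decomp-kz lens-1 g13 Layer4_v1.lean @897236f9 minus the RungFour prelude block (imported from …RungFourPreludeP14); --supports stmt-KontsevichZagierPeriods-27141.
Split by census-1 g10 `gen/splitlean.py`: scopes re-opened with their `open`/`variable`/`set_option` context; mathematics and declaration order unchanged. -/

set_option linter.dupNamespace false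
noncomputable section
set_option linter.dupNamespace false
set_option linter.unusedVariables false
set_option linter.unusedSectionVars false
set_option linter.unusedSimpArgs false
open Set MeasureTheory MvPolynomial
open Literature.NumberTheory.Transcendental
open Summit.KontsevichZagierPeriods.KontsevichZagierPeriods.Theorems.RootDecompZetaThreeFrontierWordMoves
open Summit.KontsevichZagierPeriods.KontsevichZagierPeriods.Cruxes.GZNormalFormWThree.GZLadder.RungThree (congInto_mono congInto_of_mem_closure congInto_of_sub_mem)

/-- Auxiliary step `vec4_3` (§L4): vec4 3. [bookkeeping] -/
private theorem vec4_3 (a b c d : ℝ) : (![a, b, c, d] : Fin 4 → ℝ) 3 = d := rfl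

/-- Auxiliary step `vec4_2` (§L4): vec4 2. [bookkeeping] -/
private theorem vec4_2 (a b c d : ℝ) : (![a, b, c, d] : Fin 4 → ℝ) 2 = c := rfl

/-- Auxiliary step `vec4_1` (§L4): vec4 1. [bookkeeping] -/
private theorem vec4_1 (a b c d : ℝ) : (![a, b, c, d] : Fin 4 → ℝ) 1 = b := rfl

/-- Auxiliary step `vec4_0` (§L4): vec4 0. [bookkeeping] -/
private theorem vec4_0 (a b c d : ℝ) : (![a, b, c, d] : Fin 4 → ℝ) 0 = a := rfl

/-- Auxiliary step `exists_measurableEquiv_snoc` (§W1): exists measurable Equiv snoc. [bookkeeping] -/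
private theorem exists_measurableEquiv_snoc (N : ℕ) :
    ∃ e : (Fin (N + 1) → ℝ) ≃ᵐ (Fin N → ℝ) × ℝ,
      MeasurePreserving e volume ((volume : Measure (Fin N → ℝ)).prod (volume : Measure ℝ)) ∧
      ∀ q, e.symm q = Fin.snoc q.1 q.2 := by
  refine ⟨(MeasurableEquiv.piFinSuccAbove (fun _ => ℝ) (Fin.last N)).trans
    MeasurableEquiv.prodComm, ?_, fun q => ?_⟩
  · refine (volume_preserving_piFinSuccAbove (fun _ => ℝ) (Fin.last N)).trans ?_
    rw [Measure.volume_eq_prod]; exact Measure.measurePreserving_swap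
  · show (MeasurableEquiv.piFinSuccAbove (fun _ => ℝ) (Fin.last N)).symm (q.2, q.1) = _
    rw [MeasurableEquiv.piFinSuccAbove_symm_apply, Fin.insertNthEquiv_last]; rfl

open Set MeasureTheory MvPolynomial in
open Literature.NumberTheory.Transcendental in
open Summit.KontsevichZagierPeriods.KontsevichZagierPeriods.Theorems.RootDecompZetaThreeFrontierWordMoves in
open Summit.KontsevichZagierPeriods.KontsevichZagierPeriods.Cruxes.GZNormalFormWThree.GZLadder.RungFour in
open Summit.KontsevichZagierPeriods.KontsevichZagierPeriods.Cruxes.GZNormalFormWThree.GZLadder.WlogFour in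
open Summit.KontsevichZagierPeriods.KontsevichZagierPeriods.Cruxes.GZNormalFormWThree.GZLadder.MatchFour in
open Summit.KontsevichZagierPeriods.KontsevichZagierPeriods.Cruxes.GZNormalFormWThree.GZLadder.GapForm in
open Literature.ModelTheory.ExponentialFields (IsSemialgebraic) in
/-- **Newton–Leibniz over an open band, packaged** (verbatim copy of the landed private
`WordLayer.newtonLeibniz_pack` = `JanusBands.IntegrateOut.newtonLeibniz_pack`, with the public `WlogFour.exists_measurableEquiv_snoc`).
[Kontsevich–Zagier 2001, §1.2, rule (3)] [folklore] -/
private theorem newtonLeibniz_pack4 {N : ℕ} {τ : Set (Fin N → ℝ)} (hτ : IsSemialgebraic ℚ τ)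
    {a b : (Fin N → ℝ) → ℝ} (ha : IsSemialgebraicFunOn ℚ τ a) (hb : IsSemialgebraicFunOn ℚ τ b)
    (hab : ∀ x ∈ τ, a x < b x) {f F : (Fin (N + 1) → ℝ) → ℝ}
    (hf : IsSemialgebraicFunOn ℚ (KZlog.band τ a b) f)
    (hF : IsSemialgebraicFunOn ℚ (KZlog.band τ a b) F)
    (hcont : ∀ x ∈ τ, ContinuousOn (fun t => F (Fin.snoc x t)) (Icc (a x) (b x)))
    (hder : ∀ x ∈ τ, ∀ t ∈ Ioo (a x) (b x),
      HasDerivAt (fun s => F (Fin.snoc x s)) (f (Fin.snoc x t)) t)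
    (r : KZ.IntegralRep (N + 1))
    (hrd : r.domain = {z | (Fin.init z : Fin N → ℝ) ∈ τ ∧ a (Fin.init z) < z (Fin.last N) ∧
      z (Fin.last N) < b (Fin.init z)})
    (hri : EqOn r.integrand f r.domain) :
    ∃ r' : KZ.IntegralRep N, r'.domain = τ ∧
      (r'.integrand = fun x => F (Fin.snoc x (b x)) - F (Fin.snoc x (a x))) ∧
      KZ.of r - KZ.of r' ∈ KZ.relations := by
  have hτm : MeasurableSet τ := IsSemialgebraic.measurableSet_holds hτ
  have hBsa : IsSemialgebraic ℚ (KZlog.band τ a b) := KZlog.isSemialgebraic_band ha hb; have hBm : MeasurableSet (KZlog.band τ a b) := IsSemialgebraic.measurableSet_holds hBsa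
  have hsub : r.domain ⊆ KZlog.band τ a b := by
    rw [hrd]; exact fun z hz => ⟨hz.1, hz.2.1.le, hz.2.2.le⟩
  have hdiff : KZlog.band τ a b \ r.domain ⊆
      {z | (Fin.init z : Fin N → ℝ) ∈ τ ∧ z (Fin.last N) = a (Fin.init z)} ∪
        {z | (Fin.init z : Fin N → ℝ) ∈ τ ∧ z (Fin.last N) = b (Fin.init z)} := by
    rw [hrd]; rintro z ⟨⟨hzτ, h1, h2⟩, hz⟩; simp only [mem_setOf_eq, not_and, not_lt] at hz; rcases h1.lt_or_eq with h1 | h1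
    · exact Or.inr ⟨hzτ, le_antisymm h2 (hz hzτ h1)⟩
    · exact Or.inl ⟨hzτ, h1.symm⟩
  have hnull : volume (KZlog.band τ a b \ r.domain) = 0 :=
    measure_mono_null hdiff (measure_union_null (KZ.volume_graph_eq_zero ha)
      (KZ.volume_graph_eq_zero hb))
  have hfO : IntegrableOn f r.domain :=
    r.integrableOn.congr_fun hri (KZ.IntegralRep.measurableSet_domain_holds r)
  have hfB : IntegrableOn f (KZlog.band τ a b) := by
    rw [← Set.union_sdiff_cancel hsub]; exact integrableOn_union.mpr ⟨hfO, IntegrableOn.of_measure_zero hnull⟩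
  let r₂ : KZ.IntegralRep (N + 1) := ⟨KZlog.band τ a b, f, hBsa, hf, hfB⟩
  have h12 : KZ.of r - KZ.of r₂ ∈ KZ.relations := by
    refine KZ.of_sub_of_mem_relations_of_null r r₂ ?_ hnull fun z hz => hri hz.1
    rw [Set.sdiff_eq_empty.mpr hsub, measure_empty]
  have hmap : ∀ {c : (Fin N → ℝ) → ℝ}, IsSemialgebraicFunOn ℚ τ c →
      (∀ x ∈ τ, c x ∈ Icc (a x) (b x)) →
      IsSemialgebraicFunOn ℚ τ (fun x => F (Fin.snoc x (c x))) := by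
    intro c hc hcm
    have hφ : IsSemialgebraicMapOn ℚ τ (fun x => (Fin.snoc x (c x) : Fin (N + 1) → ℝ)) := by
      refine IsSemialgebraicMapOn.of_forall hτ fun j => ?_
      refine Fin.lastCases ?_ (fun i => ?_) j
      · simpa using hc
      · simpa using isSemialgebraicFunOn_apply hτ i
    exact IsSemialgebraicFunOn.comp_isSemialgebraicMapOn_holds hF hφ
      fun x hx => KZlog.snoc_mem_band.mpr ⟨hx, hcm x hx⟩
  have hgsa : IsSemialgebraicFunOn ℚ τ (fun x => F (Fin.snoc x (b x)) - F (Fin.snoc x (a x))) :=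
    IsSemialgebraicFunOn.sub_holds (hmap hb fun x hx => Set.right_mem_Icc.mpr (hab x hx).le)
      (hmap ha fun x hx => Set.left_mem_Icc.mpr (hab x hx).le)
  set G : (Fin (N + 1) → ℝ) → ℝ := (KZlog.band τ a b).indicator f with hG_def
  have hG : Integrable G := (integrable_indicator_iff hBm).mpr hfB; obtain ⟨e, he, he_symm⟩ := exists_measurableEquiv_snoc N
  have hG2 : Integrable (fun q : (Fin N → ℝ) × ℝ => G (Fin.snoc q.1 q.2))
      ((volume : Measure (Fin N → ℝ)).prod (volume : Measure ℝ)) := by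
    have h := ((he.symm e).integrable_comp_emb e.symm.measurableEmbedding (g := G)).mpr hG; convert h using 1; ext q; simp [he_symm]
  have hfib_in : ∀ x ∈ τ, (fun t => G (Fin.snoc x t)) =
      (Icc (a x) (b x)).indicator (fun t => f (Fin.snoc x t)) := by
    intro x hx; ext t; by_cases ht : t ∈ Icc (a x) (b x)
    · rw [indicator_of_mem ht, hG_def, indicator_of_mem (KZlog.snoc_mem_band.mpr ⟨hx, ht⟩)]
    · rw [indicator_of_notMem ht, hG_def,
        indicator_of_notMem (fun h => ht (KZlog.snoc_mem_band.mp h).2)]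
  have hgx : ∀ x ∈ τ, Integrable (fun t => G (Fin.snoc x t)) →
      F (Fin.snoc x (b x)) - F (Fin.snoc x (a x)) = ∫ t, G (Fin.snoc x t) := by
    intro x hx hxi
    rw [hfib_in x hx, integral_indicator measurableSet_Icc, integral_Icc_eq_integral_Ioc,
      ← intervalIntegral.integral_of_le (hab x hx).le]
    refine (intervalIntegral.integral_eq_sub_of_hasDerivAt_of_le (hab x hx).le (hcont x hx)
      (hder x hx) ?_).symm
    rw [intervalIntegrable_iff_integrableOn_Icc_of_le (hab x hx).le]; have h' := hxi; rw [hfib_in x hx] at h'; exact (integrable_indicator_iff measurableSet_Icc).mp h'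
  have hgi : IntegrableOn (fun x => F (Fin.snoc x (b x)) - F (Fin.snoc x (a x))) τ := by
    refine Integrable.mono' hG2.integral_norm_prod_left.integrableOn.integrable
      (KZ.aestronglyMeasurable_of_isSemialgebraicFunOn hgsa hτm) ?_
    rw [ae_restrict_iff' hτm]; filter_upwards [hG2.prod_right_ae] with x hx hxτ
    rw [hgx x hxτ hx]; exact norm_integral_le_integral_norm _
  let r' : KZ.IntegralRep N :=
    ⟨τ, fun x => F (Fin.snoc x (b x)) - F (Fin.snoc x (a x)), hτ, hgsa, hgi⟩
  have h23 : KZ.of r₂ - KZ.of r' ∈ KZ.relations :=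
    KZ.newtonLeibnizRel_subset_relations ⟨N, r₂, r', a, b, F, hF, ha, hb,
      fun x hx => (hab x hx).le, rfl, hcont, hder, fun x _ => rfl, rfl⟩
  refine ⟨r', rfl, rfl, ?_⟩; have : KZ.of r - KZ.of r' = (KZ.of r - KZ.of r₂) + (KZ.of r₂ - KZ.of r') := by abel
  rw [this]; exact KZ.relations.add_mem h12 h23

/-- Auxiliary step `mem_simplex_four_iff` (§W5): mem simplex four iff. [bookkeeping] -/
private theorem mem_simplex_four_iff (t : Fin 4 → ℝ) :
    t ∈ KZ.openOrderedSimplex 4 ↔ 0 < t 3 ∧ t 3 < t 2 ∧ t 2 < t 1 ∧ t 1 < t 0 ∧ t 0 < 1 := by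
  constructor
  · rintro ⟨h0, h1, ha⟩
    exact ⟨h0 3, ha (show (2 : Fin 4) < 3 by decide), ha (show (1 : Fin 4) < 2 by decide),
      ha (show (0 : Fin 4) < 1 by decide), h1 0⟩
  · rintro ⟨h3, h32, h21, h10, h0⟩
    have hsa : StrictAnti t := by
      refine Fin.strictAnti_iff_succ_lt.mpr fun i => ?_
      fin_cases i
      · simpa using h10
      · simpa using h21
      · simpa using h32
    exact ⟨fun i => lt_of_lt_of_le h3 (hsa.antitone (Fin.le_last i)),
      fun i => lt_of_le_of_lt (hsa.antitone (Fin.le_iff_val_le_val.2 (Nat.zero_le _))) h0, hsa⟩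

/-- Auxiliary step `abs_det_of_invol4` (§W4): abs det of invol4. [bookkeeping] -/
private theorem abs_det_of_invol4 {L : (Fin 4 → ℝ) →L[ℝ] (Fin 4 → ℝ)} (h : ∀ w, L (L w) = w) : |L.det| = 1 := by
  have hcomp : (L : (Fin 4 → ℝ) →ₗ[ℝ] (Fin 4 → ℝ)) ∘ₗ (L : (Fin 4 → ℝ) →ₗ[ℝ] (Fin 4 → ℝ)) = LinearMap.id := by
    apply LinearMap.ext; intro w; simp [h]
  have h1 := congrArg LinearMap.det hcomp; rw [LinearMap.det_comp, LinearMap.det_id] at h1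
  have h2 : |LinearMap.det (L : (Fin 4 → ℝ) →ₗ[ℝ] (Fin 4 → ℝ))| ^ 2 = 1 := by
    rw [sq_abs, sq, h1]
  exact (pow_eq_one_iff_of_nonneg (abs_nonneg _) two_ne_zero).1 h2

namespace Summit.KontsevichZagierPeriods.KontsevichZagierPeriods.Cruxes.GZNormalFormWThree.GZLadder.LayerFour
open Summit.KontsevichZagierPeriods.KontsevichZagierPeriods.Cruxes.GZNormalFormWThree.GZLadder.RungFour
open Summit.KontsevichZagierPeriods.KontsevichZagierPeriods.Cruxes.GZNormalFormWThree.GZLadder.WlogFour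
open Summit.KontsevichZagierPeriods.KontsevichZagierPeriods.Cruxes.GZNormalFormWThree.GZLadder.MatchFour
open Summit.KontsevichZagierPeriods.KontsevichZagierPeriods.Cruxes.GZNormalFormWThree.GZLadder.GapForm
open Literature.ModelTheory.ExponentialFields (IsSemialgebraic)

/-- the coordinate transposition `(t₀,t₁,t₂,t₃) ↦ (t₀,t₁,t₃,t₂)` -/
def sw4 (z : Fin 4 → ℝ) : Fin 4 → ℝ := ![z 0, z 1, z 3, z 2]
/-- its linear part (itself) -/
def sw4L : (Fin 4 → ℝ) →L[ℝ] (Fin 4 → ℝ) := ContinuousLinearMap.pi ![Pj4 0, Pj4 1, Pj4 3, Pj4 2]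

/-- Auxiliary step `sw4_zero` (§L5): sw4 zero. [bookkeeping] -/
theorem sw4_zero (z : Fin 4 → ℝ) : sw4 z 0 = z 0 := by simp [sw4]
/-- Auxiliary step `sw4_one` (§L5): sw4 one. [bookkeeping] -/
theorem sw4_one (z : Fin 4 → ℝ) : sw4 z 1 = z 1 := by simp [sw4]
/-- Auxiliary step `sw4_two` (§L5): sw4 two. [bookkeeping] -/
theorem sw4_two (z : Fin 4 → ℝ) : sw4 z 2 = z 3 := by simp [sw4]
/-- Auxiliary step `sw4_three` (§L5): sw4 three. [bookkeeping] -/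
theorem sw4_three (z : Fin 4 → ℝ) : sw4 z 3 = z 2 := by simp [sw4]

/-- Auxiliary step `sw4_eq_L` (§L5): sw4 eq L. [bookkeeping] -/
theorem sw4_eq_L (z : Fin 4 → ℝ) : sw4 z = sw4L z := by
  funext i
  fin_cases i <;> simp [sw4, sw4L]

/-- Auxiliary step `sw4_sw4` (§L5): sw4 sw4. [bookkeeping] -/
theorem sw4_sw4 (z : Fin 4 → ℝ) : sw4 (sw4 z) = z := by
  funext i
  fin_cases i <;> simp [sw4_zero, sw4_one, sw4_two, sw4_three]
/-- Auxiliary step `sw4L_sw4L` (§L5): sw4 L sw4 L. [bookkeeping] -/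
theorem sw4L_sw4L (w : Fin 4 → ℝ) : sw4L (sw4L w) = w := by
  rw [← sw4_eq_L, ← sw4_eq_L, sw4_sw4]
/-- Auxiliary step `hasFDerivAt_sw4` (§L5): has FDeriv At sw4. [bookkeeping] -/
theorem hasFDerivAt_sw4 (x : Fin 4 → ℝ) : HasFDerivAt sw4 sw4L x := by
  have e : sw4 = fun z => sw4L z := funext sw4_eq_L
  rw [e]; exact sw4L.hasFDerivAt
/-- Auxiliary step `abs_det_sw4L` (§L5): abs det sw4 L. [bookkeeping] -/
theorem abs_det_sw4L : |sw4L.det| = 1 := abs_det_of_invol4 sw4L_sw4L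
/-- the open band `u₂ < u₃ < u₁` over `Δ₃` = the transposed simplex `sw4 '' Δ₄` (written in the shape `newtonLeibniz_pack4` wants) -/
def dom2 : Set (Fin 4 → ℝ) :=
  {z | (Fin.init z : Fin 3 → ℝ) ∈ KZ.openOrderedSimplex 3 ∧ (fun y : Fin 3 → ℝ => y (Fin.last 2)) (Fin.init z) < z (Fin.last 3) ∧
    z (Fin.last 3) < (fun y : Fin 3 → ℝ => y 1) (Fin.init z)}
/-- Auxiliary step `mem_dom2_iff` (§L5): mem dom2 iff. [bookkeeping] -/
theorem mem_dom2_iff (z : Fin 4 → ℝ) : z ∈ dom2 ↔ (0 < z 2 ∧ z 2 < z 1 ∧ z 1 < z 0 ∧ z 0 < 1) ∧ z 2 < z 3 ∧ z 3 < z 1 := by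
  simp only [dom2, mem_setOf_eq, mem_simplex_three_iff]; exact Iff.rfl
/-- Auxiliary step `sw4_mem_dom2` (§L5): sw4 mem dom2. [bookkeeping] -/
theorem sw4_mem_dom2 {t : Fin 4 → ℝ} (ht : t ∈ KZ.openOrderedSimplex 4) : sw4 t ∈ dom2 := by
  rw [mem_dom2_iff, sw4_zero, sw4_one, sw4_two, sw4_three]; obtain ⟨h3, h32, h21, h10, h0⟩ := (mem_simplex_four_iff t).1 ht; exact ⟨⟨h3, h32.trans h21, h10, h0⟩, h32, h21⟩
/-- Auxiliary step `sw4_mem_simplex_of_dom2` (§L5): sw4 mem simplex of dom2. [bookkeeping] -/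
theorem sw4_mem_simplex_of_dom2 {z : Fin 4 → ℝ} (hz : z ∈ dom2) : sw4 z ∈ KZ.openOrderedSimplex 4 := by
  rw [mem_simplex_four_iff, sw4_zero, sw4_one, sw4_two, sw4_three]; obtain ⟨⟨h2, h21, h10, h0⟩, h23, h31⟩ := (mem_dom2_iff z).1 hz; exact ⟨h2, h23, h31, h10, h0⟩
/-- Auxiliary step `image_sw4` (§L5): image sw4. [bookkeeping] -/
theorem image_sw4 : sw4 '' KZ.openOrderedSimplex 4 = dom2 := by
  ext z; constructor
  · rintro ⟨w, hw, rfl⟩; exact sw4_mem_dom2 hw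
  · intro hz; exact ⟨sw4 z, sw4_mem_simplex_of_dom2 hz, sw4_sw4 z⟩
/-- Auxiliary step `isSemialgebraicMapOn_sw4` (§L5): is Semialgebraic Map On sw4. [bookkeeping] -/
theorem isSemialgebraicMapOn_sw4 {S : Set (Fin 4 → ℝ)} (hS : IsSemialgebraic ℚ S) : IsSemialgebraicMapOn ℚ S sw4 :=
  (isSemialgebraicMapOn_aeval hS ![MvPolynomial.X 0, MvPolynomial.X 1, MvPolynomial.X 3, MvPolynomial.X 2]).congr
    fun z _ => by
      funext j
      fin_cases j <;> simp [sw4_zero, sw4_one, sw4_two, sw4_three]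
/-- `dom2` is `ℚ`-semialgebraic (image of `Δ₄` under a polynomial map; Tarski–Seidenberg). [BCR1998 Prop. 2.2.7] -/
theorem isSemialgebraic_dom2 : IsSemialgebraic ℚ dom2 := by
  rw [← image_sw4]
  exact IsSemialgebraicMapOn.isSemialgebraic_image_holds (isSemialgebraicMapOn_sw4 (KZ.isSemialgebraic_openOrderedSimplex 4))
    subset_rfl (KZ.isSemialgebraic_openOrderedSimplex 4)
/-- `F` integrable on `Δ₄` ⟹ `F ∘ sw4` integrable on `dom2 = sw4 '' Δ₄` -/
theorem integrableOn_comp_sw4 {F : (Fin 4 → ℝ) → ℝ} (hF : IntegrableOn F (KZ.openOrderedSimplex 4)) :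
    IntegrableOn (fun z => F (sw4 z)) dom2 := by
  have hm := measurableSet_simplex 4
  have key := (integrableOn_image_iff_integrableOn_abs_det_fderiv_smul (μ := volume) hm
    (fun x _ => (hasFDerivAt_sw4 x).hasFDerivWithinAt) (fun a _ b _ h => by
      have := congrArg sw4 h
      rwa [sw4_sw4, sw4_sw4] at this) (fun z => F (sw4 z))).2
    (hF.congr_fun (fun p _ => by simp [abs_det_sw4L, sw4_sw4]) hm)
  rwa [image_sw4] at key
/-- the transposed representation `[dom2, r.integrand ∘ sw4]` -/
def swRep (r : KZ.IntegralRep 4) (hd : r.domain = KZ.openOrderedSimplex 4) : KZ.IntegralRep 4 :=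
  ⟨dom2, fun u => r.integrand (sw4 u), isSemialgebraic_dom2,
    IsSemialgebraicFunOn.comp_isSemialgebraicMapOn_holds (hd ▸ r.isSemialgebraicFunOn_integrand) (isSemialgebraicMapOn_sw4 isSemialgebraic_dom2)
      fun _ hz => sw4_mem_simplex_of_dom2 hz,
    integrableOn_comp_sw4 (hd ▸ r.integrableOn)⟩
/-- Auxiliary step `swRep_integrand` (§L5): sw Rep integrand. [bookkeeping] -/
theorem swRep_integrand (r : KZ.IntegralRep 4) (hd : r.domain = KZ.openOrderedSimplex 4) (u : Fin 4 → ℝ) :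
    (swRep r hd).integrand u = r.integrand (sw4 u) := rfl
/-- **the transposition move** (rule 2 with `sw4`, `|det| = 1`): `[Δ₄, f] ≡ [dom2, f ∘ sw4]` -/
theorem sw_move (r : KZ.IntegralRep 4) (hd : r.domain = KZ.openOrderedSimplex 4) :
    KZ.of r - KZ.of (swRep r hd) ∈ KZ.relations := by
  have hΦsa : IsSemialgebraicMapOn ℚ r.domain sw4 := by rw [hd]; exact isSemialgebraicMapOn_sw4 (KZ.isSemialgebraic_openOrderedSimplex 4)
  have hder : ∀ x ∈ r.domain, HasFDerivWithinAt sw4 sw4L r.domain x := fun x _ => (hasFDerivAt_sw4 x).hasFDerivWithinAt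
  have hinj : InjOn sw4 r.domain := fun a _ b _ hab => by
    have := congrArg sw4 hab; rwa [sw4_sw4, sw4_sw4] at this
  have hdom : (swRep r hd).domain = sw4 '' r.domain := by rw [hd, image_sw4]; rfl
  refine KZ.changeOfVariablesRel_subset_relations ⟨4, r, swRep r hd, sw4, fun _ => sw4L, hΦsa, hder, hinj, hdom, fun z _ => ?_, rfl⟩
  show r.integrand z = r.integrand (sw4 (sw4 z)) * |sw4L.det|; rw [abs_det_sw4L, mul_one, sw4_sw4]
/-- the closed band `u₂ ≤ u₃ ≤ u₁` over `Δ₃` -/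
def band2 : Set (Fin 4 → ℝ) :=
  KZlog.band (KZ.openOrderedSimplex 3) (fun y : Fin 3 → ℝ => y (Fin.last 2)) (fun y : Fin 3 → ℝ => y 1)
/-- Auxiliary step `mem_band2_iff` (§L5): mem band2 iff. [bookkeeping] -/
theorem mem_band2_iff (z : Fin 4 → ℝ) :
    z ∈ band2 ↔ (0 < z 2 ∧ z 2 < z 1 ∧ z 1 < z 0 ∧ z 0 < 1) ∧ z 2 ≤ z 3 ∧ z 3 ≤ z 1 := by
  rw [band2, KZlog.mem_band, mem_simplex_three_iff]; exact Iff.rfl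
/-- Auxiliary step `isSemialgebraic_band2` (§L5): is Semialgebraic band2. [bookkeeping] -/
theorem isSemialgebraic_band2 : IsSemialgebraic ℚ band2 := by
  have hτ := KZ.isSemialgebraic_openOrderedSimplex 3
  exact KZlog.isSemialgebraic_band
    ((isSemialgebraicFunOn_aeval hτ (MvPolynomial.X (Fin.last 2))).congr fun y _ => by simp)
    ((isSemialgebraicFunOn_aeval hτ (MvPolynomial.X 1)).congr fun y _ => by simp)
/-- **Newton–Leibniz in the direction `t₂`** (transposition move + `newtonLeibniz_pack4` over the band `u₂ < u₃ < u₁`):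
if `r.integrand = f ∘ sw4` on `Δ₄` and `F` is a fibrewise primitive of `f` on the band, then
`[Δ₄, r.integrand] ≡ [Δ₃, F(y, y₁) - F(y, y₂)]`. [Kontsevich–Zagier 2001 §1.2 rules (2), (3)] -/
theorem nlDir2 {f F : (Fin 4 → ℝ) → ℝ} (hf : IsSemialgebraicFunOn ℚ band2 f) (hF : IsSemialgebraicFunOn ℚ band2 F)
    (hcont : ∀ y ∈ KZ.openOrderedSimplex 3, ContinuousOn (fun t => F (Fin.snoc y t)) (Icc (y (Fin.last 2)) (y 1)))
    (hder : ∀ y ∈ KZ.openOrderedSimplex 3, ∀ t ∈ Ioo (y (Fin.last 2)) (y 1),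
      HasDerivAt (fun s => F (Fin.snoc y s)) (f (Fin.snoc y t)) t)
    (r : KZ.IntegralRep 4) (hd : r.domain = KZ.openOrderedSimplex 4) (hi : ∀ t ∈ r.domain, r.integrand t = f (sw4 t)) :
    ∃ r' : KZ.IntegralRep 3, r'.domain = KZ.openOrderedSimplex 3 ∧
      (r'.integrand = fun y => F (Fin.snoc y (y 1)) - F (Fin.snoc y (y (Fin.last 2)))) ∧
      KZ.of r - KZ.of r' ∈ KZ.relations := by
  have hτ := KZ.isSemialgebraic_openOrderedSimplex 3
  have ha : IsSemialgebraicFunOn ℚ (KZ.openOrderedSimplex 3) (fun y : Fin 3 → ℝ => y (Fin.last 2)) :=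
    (isSemialgebraicFunOn_aeval hτ (MvPolynomial.X (Fin.last 2))).congr fun y _ => by simp
  have hb : IsSemialgebraicFunOn ℚ (KZ.openOrderedSimplex 3) (fun y : Fin 3 → ℝ => y 1) :=
    (isSemialgebraicFunOn_aeval hτ (MvPolynomial.X 1)).congr fun y _ => by simp
  have hab : ∀ y ∈ KZ.openOrderedSimplex 3, (fun y : Fin 3 → ℝ => y (Fin.last 2)) y < (fun y : Fin 3 → ℝ => y 1) y :=
    fun y hy => ((mem_simplex_three_iff y).1 hy).2.1
  have hri : EqOn (swRep r hd).integrand f (swRep r hd).domain := fun u hu => by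
    show r.integrand (sw4 u) = f u; rw [hi _ (by rw [hd]; exact sw4_mem_simplex_of_dom2 hu), sw4_sw4]
  obtain ⟨r', hd', hi', hrel⟩ := newtonLeibniz_pack4 hτ ha hb hab hf hF hcont hder (swRep r hd) rfl hri
  refine ⟨r', hd', hi', ?_⟩; have e : KZ.of r - KZ.of r' = (KZ.of r - KZ.of (swRep r hd)) + (KZ.of (swRep r hd) - KZ.of r') := by abel
  rw [e]; exact add_mem (sw_move r hd) hrel
/-- the substitution `P ↦ P ∘ sw4` -/
def sw4P : MvPolynomial (Fin 4) ℚ →ₐ[ℚ] MvPolynomial (Fin 4) ℚ :=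
  MvPolynomial.bind₁ ![MvPolynomial.X 0, MvPolynomial.X 1, MvPolynomial.X 3, MvPolynomial.X 2]
/-- Auxiliary step `sw4P_sw4P` (§L5): sw4 P sw4 P. [bookkeeping] -/
theorem sw4P_sw4P (p : MvPolynomial (Fin 4) ℚ) : sw4P (sw4P p) = p := by
  have h : sw4P.comp sw4P = AlgHom.id ℚ _ := MvPolynomial.algHom_ext fun i => by
    fin_cases i <;> simp [sw4P, MvPolynomial.bind₁_X_right]
  exact AlgHom.congr_fun h p
/-- Auxiliary step `aeval_sw4P` (§L5): aeval sw4 P. [bookkeeping] -/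
theorem aeval_sw4P (p : MvPolynomial (Fin 4) ℚ) (t : Fin 4 → ℝ) :
    MvPolynomial.aeval t (sw4P p) = MvPolynomial.aeval (sw4 t) p := by
  have e : (fun i => MvPolynomial.aeval t
      ((![MvPolynomial.X 0, MvPolynomial.X 1, MvPolynomial.X 3, MvPolynomial.X 2] : Fin 4 → MvPolynomial (Fin 4) ℚ) i)) = sw4 t := by
    funext i
    fin_cases i <;> simp [sw4_zero, sw4_one, sw4_two, sw4_three]
  rw [sw4P, MvPolynomial.aeval_bind₁, e]
/-- the 9-factor class in transposed coordinates (`u₃ = t₂` is the fibre coordinate) -/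
def layU (Q : MvPolynomial (Fin 4) ℚ) (β0 β1 β2 γ1 γ2 γ3 α02 α03 α13 : ℕ) (u : Fin 4 → ℝ) : ℝ :=
  MvPolynomial.aeval u Q / (u 0 ^ β0 * u 1 ^ β1 * u 3 ^ β2 * (1 - u 1) ^ γ1 * (1 - u 3) ^ γ2 * (1 - u 2) ^ γ3 * (u 0 - u 3) ^ α02 *
    (u 0 - u 2) ^ α03 * (u 1 - u 2) ^ α13)
/-- Auxiliary step `layF_sw4` (§L5): lay F sw4. [bookkeeping] -/
theorem layF_sw4 (P : MvPolynomial (Fin 4) ℚ) (β0 β1 β2 γ1 γ2 γ3 α02 α03 α13 : ℕ) (u : Fin 4 → ℝ) :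
    layF P β0 β1 β2 γ1 γ2 γ3 α02 α03 α13 (sw4 u) = layU (sw4P P) β0 β1 β2 γ1 γ2 γ3 α02 α03 α13 u := by
  simp only [layF, layU, aeval_sw4P, sw4_zero, sw4_one, sw4_two, sw4_three]
/-- Auxiliary step `layU_sw4` (§L5): lay U sw4. [bookkeeping] -/
theorem layU_sw4 (Q : MvPolynomial (Fin 4) ℚ) (β0 β1 β2 γ1 γ2 γ3 α02 α03 α13 : ℕ) (t : Fin 4 → ℝ) :
    layU Q β0 β1 β2 γ1 γ2 γ3 α02 α03 α13 (sw4 t) = layF (sw4P Q) β0 β1 β2 γ1 γ2 γ3 α02 α03 α13 t := by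
  have h := layF_sw4 (sw4P Q) β0 β1 β2 γ1 γ2 γ3 α02 α03 α13 (sw4 t); rw [sw4_sw4, sw4P_sw4P] at h; exact h.symm
/-- the t₂-IBP numerator (in transposed coordinates, fibre variable `X 3`):
`∂₃Q·u₃(1-u₃)(u₀-u₃) + Q·(γ₂ u₃(u₀-u₃) + α₀₂ u₃(1-u₃) - β₂ (1-u₃)(u₀-u₃))` -/
def ibpQ2 (Q : MvPolynomial (Fin 4) ℚ) (β2 γ2 α02 : ℕ) : MvPolynomial (Fin 4) ℚ :=
  MvPolynomial.pderiv 3 Q * (MvPolynomial.X 3 * (MvPolynomial.C 1 - MvPolynomial.X 3) * (MvPolynomial.X 0 - MvPolynomial.X 3)) +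
    Q * (MvPolynomial.C (γ2 : ℚ) * (MvPolynomial.X 3 * (MvPolynomial.X 0 - MvPolynomial.X 3)) +
      MvPolynomial.C (α02 : ℚ) * (MvPolynomial.X 3 * (MvPolynomial.C 1 - MvPolynomial.X 3)) -
      MvPolynomial.C (β2 : ℚ) * ((MvPolynomial.C 1 - MvPolynomial.X 3) * (MvPolynomial.X 0 - MvPolynomial.X 3)))
/-- the combined boundary numerator of the t₂-engine over the common denominator
`y₀^{β₀} y₁^{β₁+β₂} y₂^{β₂} (1-y₁)^{γ₁+γ₂} (1-y₂)^{γ₂+γ₃} (y₀-y₁)^{α₀₂} (y₀-y₂)^{α₀₂+α₀₃} (y₁-y₂)^{α₁₃}` (faces `t₂ = t₁` minus `t₂ = t₃`) -/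
def ibpB2 (Q : MvPolynomial (Fin 4) ℚ) (β2 γ2 α02 : ℕ) : MvPolynomial (Fin 3) ℚ :=
  MvPolynomial.bind₁ ![MvPolynomial.X 0, MvPolynomial.X 1, MvPolynomial.X 2, MvPolynomial.X 1] Q *
      (MvPolynomial.X 2 ^ β2 * (MvPolynomial.C 1 - MvPolynomial.X 2) ^ γ2 * (MvPolynomial.X 0 - MvPolynomial.X 2) ^ α02) -
    MvPolynomial.bind₁ ![MvPolynomial.X 0, MvPolynomial.X 1, MvPolynomial.X 2, MvPolynomial.X 2] Q *
      (MvPolynomial.X 1 ^ β2 * (MvPolynomial.C 1 - MvPolynomial.X 1) ^ γ2 * (MvPolynomial.X 0 - MvPolynomial.X 1) ^ α02)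
/-- Auxiliary step `layU_sa_band2` (§L5): lay U sa band2. [bookkeeping] -/
theorem layU_sa_band2 (Q : MvPolynomial (Fin 4) ℚ) (β0 β1 β2 γ1 γ2 γ3 α02 α03 α13 : ℕ) :
    IsSemialgebraicFunOn ℚ band2 (layU Q β0 β1 β2 γ1 γ2 γ3 α02 α03 α13) := by
  refine (isSemialgebraicFunOn_aeval_div_aeval isSemialgebraic_band2 Q
    (MvPolynomial.X 0 ^ β0 * MvPolynomial.X 1 ^ β1 * MvPolynomial.X 3 ^ β2 * (MvPolynomial.C 1 - MvPolynomial.X 1) ^ γ1 *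
      (MvPolynomial.C 1 - MvPolynomial.X 3) ^ γ2 * (MvPolynomial.C 1 - MvPolynomial.X 2) ^ γ3 *
      (MvPolynomial.X 0 - MvPolynomial.X 3) ^ α02 * (MvPolynomial.X 0 - MvPolynomial.X 2) ^ α03 *
      (MvPolynomial.X 1 - MvPolynomial.X 2) ^ α13) fun z hz => ?_).congr fun z hz => ?_
  · obtain ⟨⟨h2, h21, h10, h0⟩, h23, h31⟩ := (mem_band2_iff z).1 hz
    simp only [map_mul, map_pow, map_sub, MvPolynomial.aeval_X, map_one]; have a0 : z 0 ≠ 0 := by linarith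
    have a1 : z 1 ≠ 0 := by linarith
    have a2 : z 3 ≠ 0 := by linarith
    have a3 : (1 : ℝ) - z 1 ≠ 0 := by linarith
    have a4 : (1 : ℝ) - z 3 ≠ 0 := by linarith
    have a5 : (1 : ℝ) - z 2 ≠ 0 := by linarith
    have a6 : z 0 - z 3 ≠ 0 := by linarith
    have a7 : z 0 - z 2 ≠ 0 := by linarith
    have a8 : z 1 - z 2 ≠ 0 := by linarith
    exact mul_ne_zero (mul_ne_zero (mul_ne_zero (mul_ne_zero (mul_ne_zero (mul_ne_zero (mul_ne_zero (mul_ne_zero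
      (pow_ne_zero _ a0) (pow_ne_zero _ a1)) (pow_ne_zero _ a2)) (pow_ne_zero _ a3)) (pow_ne_zero _ a4)) (pow_ne_zero _ a5))
      (pow_ne_zero _ a6)) (pow_ne_zero _ a7)) (pow_ne_zero _ a8)
  · simp only [map_mul, map_pow, map_sub, MvPolynomial.aeval_X, map_one, layU]

end Summit.KontsevichZagierPeriods.KontsevichZagierPeriods.Cruxes.GZNormalFormWThree.GZLadder.LayerFour
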